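import Summits.BirchSwinnertonDyer.BirchSwinnertonDyer.Theses.KolyvaginRankRigidityAtTwo
import Summits.BirchSwinnertonDyer.BirchSwinnertonDyer.Theorems.ErratumRoadFiveNonSurjCornerKolyJProp44Choice
import Summits.BirchSwinnertonDyer.BirchSwinnertonDyer.Theorems.Rank1ResidualJetCompatibleData
import Summits.BirchSwinnertonDyer.BirchSwinnertonDyer.Theorems.KolyvaginRankRigidityAtTwoOffHabitatIrredKolyvaginRelationAtTwo
import Literature.NumberTheory.EllipticCurves.HeegnerPointsOfConductorRationalityProofs
import Literature.NumberTheory.EllipticCurves.RingClassGalOverCyclicProofs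
import HarnessLib

/-!
# Route `KolyvaginRankRigidityAtTwo`, residual crux R_irr `OffHabitatIrredNonSurjTwoConverse`
# (stmt-BirchSwinnertonDyer-27123, LINE 8∞ `kolyvagin_depth_split_inf_irr`): T1 OFF THE HABITAT
# (local triviality of `c_M(n)` at `λ ∣ ℓ`, `ℓ ∣ n`, when the depth below vanishes) — helper, width seat krr2-p2 g10

The habitat T1 `stub_localTrivialAtConductor_of_kolyvaginRelationAtTwo` (p612374, file
`…KolyvaginCorankLowerBoundAtTwoLocalTrivialAtConductor`) consumes the `2`-adic image twice: through GK2's Q2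
`KolyvaginRelationAtTwo` (binder `∀ n, ρ_{E,2^n} onto`) and through McCallum's admissibility (5) at `2`
(`KolyvaginAtTwo.isAdmissible_pointsSubgroup_two_of_heegner`, mod-`2` surjectivity). This file is the SAME proof
with both replaced by their off-habitat suppliers on R_irr's frame `E(ℚ)[2] = 0`:
Q2 ↦ `GenusExact.kolyvaginRelationAtTwo_offHabitat_of_frobeniusCongruence h37` (p650518, modulo Gross 1991
Prop. 3.7 (2)), admissibility ↦ `GenusExact.isAdmissible_pointsSubgroup_two_of_torsionBy_eq_bot` (p650518).

* `kolyvaginClass_mem_torsionLocalKer_offHabitat_of_frobeniusCongruence` — T1 in Q2's `(m, ℓ)` currency;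
* `localTrivialAtConductor_offHabitat_of_frobeniusCongruence` — the TEXT of the habitat T1 stub with the binder
  `(∀ m, ρ_{E,2^m} onto)` replaced by `E(ℚ)[2] = 0` (plug-in replacement for the re-threading of V2irr / U2irr).

HONEST FRAMING: helper (`--supports` 27123), CONDITIONAL on the named print fact
`GrossLMS1991.prop37_2_frobeniusCongruence` (Gross 1991 Prop. 3.7 (2) = Nekovář 2007 Prop. 4.9, cite-only in the
tree); nothing here closes R_irr or its stubs; the Birch–Swinnerton-Dyer conjecture is NOT proved by any of this.

References: [McCallumLMS1991] §4 Prop. 4.4 «In particular» (p. 301), (4)–(5); [GrossLMS1991] §3 (pp. 238–239),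
Prop. 3.7 (2), §4 (4.1), Prop. 6.2 (2); [WZhang2014] Notations (xii); [Kolyvagin1991MathAnn] §2 Thm. 2.2.
-/

set_option autoImplicit false
-- the Theorems namespace of this sub repeats the summit name by design (D-0017 nested layout)
set_option linter.dupNamespace false

noncomputable section

open scoped Classical

open WeierstrassCurve Literature.NumberTheory.EllipticCurves
  Literature.NumberTheory.EllipticCurves.ModularForms NumberField IsDedekindDomain
open Summit.BirchSwinnertonDyer.BirchSwinnertonDyer.Theses.KolyvaginRankRigidityAtTwo
open Literature.NumberTheory.EllipticCurves.GrossLMS1991 (prop37_2_frobeniusCongruence)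

namespace Summit.BirchSwinnertonDyer.BirchSwinnertonDyer.Theorems.KolyvaginLowerBoundAtTwo

-- `K : Type`: the tree's ring-class class field theory is universe `0`.
variable {K : Type} [Field K] [NumberField K]

/-- **T1 off the habitat, in the `(m, ℓ)` currency of Q2.** For `W/ℚ` globally minimal elliptic, non-CM, with
`E(ℚ)[2] = 0`, `K` imaginary quadratic with `d_K ∉ {−3, −4}` and the Heegner hypothesis for `N_E`, a frame
`(Dt, β, ι)`, `mℓ` square-free (`ℓ` prime, `ℓ ∤ m`) with Zhang–Kolyvagin prime factors at `2` of index `≥ M ≥ 1`,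
ANY datum `d` of conductor `mℓ`, and every class of conductor `m` vanishing: `c_M(mℓ)(d)` is locally trivial at
the place `λ ∋ ℓ` — granted Gross 1991 Prop. 3.7 (2) (`h37`, feeding the off-habitat Q2). Steps as on the habitat:
a datum `d₀` at `m` (Gross §3 CM facts), a compatible datum at `mℓ`, Q2 off habitat at `j = 0`, choice
independence at level `mℓ` with the off-habitat admissibility. [cite: McCallumLMS1991, §4 Prop. 4.4 «In particular» (p. 301)]
[cite: GrossLMS1991, §3 (pp. 238–239), Prop. 3.7 (2), Prop. 6.2 (2)] -/
theorem kolyvaginClass_mem_torsionLocalKer_offHabitat_of_frobeniusCongruence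
    (h37 : prop37_2_frobeniusCongruence) (W : WeierstrassCurve ℚ) [W.IsElliptic] [W.IsGloballyMinimal]
    [NeZero (W.conductorNorm ℤ)] (hCM : ¬ W.HasCM)
    (htorQ : AddSubgroup.torsionBy W.toAffine.Point (2 : ℤ) = ⊥)
    (hK : IsImaginaryQuadratic K) (hne3 : NumberField.discr K ≠ -3)
    (hne4 : NumberField.discr K ≠ -4)
    (hHN : SatisfiesHeegnerHypothesis (W.conductorNorm ℤ) K)
    (Dt : ModularParametrizationData W (W.conductorNorm ℤ)) (β : ℤ) (ι : K →+* ℂ)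
    {m ℓ M : ℕ} (hsq : Squarefree (m * ℓ)) (hℓ : ℓ.Prime) (hℓm : ¬ ℓ ∣ m) (hM : 1 ≤ M)
    (hS : ∀ q ∈ (m * ℓ).primeFactors, Zhang2014.IsKolyvaginPrime (W.conductorNorm ℤ) W K 2 q ∧
      M ≤ Zhang2014.kolyvaginIndex W 2 q)
    (d : KolyvaginHeegnerData Dt β ι (m * ℓ))
    (hvan : ∀ d₀ : KolyvaginHeegnerData Dt β ι m, d₀.kolyvaginClass Nat.prime_two M = 0)
    (v : HeightOneSpectrum (𝓞 K)) (hv : ((ℓ : ℕ) : 𝓞 K) ∈ v.asIdeal) :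
    d.kolyvaginClass Nat.prime_two M ∈
      (W.baseChange K).torsionLocalKer (v.adicCompletion K) ((2 ^ M : ℕ) : ℤ) := by
  have hn0 : m * ℓ ≠ 0 := hsq.ne_zero
  have hmsq : Squarefree m := hsq.squarefree_of_dvd (dvd_mul_right m ℓ)
  have hD : NumberField.discr K < -4 :=
    Summit.BirchSwinnertonDyer.Rank1Residual.X11b.KolyvaginAssembly.discr_lt_neg_four hK ⟨hne3, hne4⟩
  have hSm : ∀ q ∈ m.primeFactors, Zhang2014.IsKolyvaginPrime (W.conductorNorm ℤ) W K 2 q :=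
    fun q hq ↦ (hS q (Nat.primeFactors_mono (dvd_mul_right m ℓ) hn0 hq)).1
  have hℓn : ℓ ∈ (m * ℓ).primeFactors := Nat.mem_primeFactors.mpr ⟨hℓ, dvd_mul_left ℓ m, hn0⟩
  have hKol : Zhang2014.IsKolyvaginPrime (W.conductorNorm ℤ) W K 2 ℓ := (hS ℓ hℓn).1
  have hℓc : ℓ ∉ m.primeFactors := fun h ↦ hℓm (Nat.dvd_of_mem_primeFactors h)
  have hinert : ∀ q ∈ m.primeFactors, (Ideal.span {(q : 𝓞 K)}).IsPrime :=
    fun q hq ↦ (hSm q hq).2.2.2.2.1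
  -- (1) SOME datum of conductor `m` (Gross 1991 §3: the two CM facts, proved in the tree)
  obtain ⟨d₀⟩ := nonempty_kolyvaginHeegnerData_of_grossCM
    (phi_heegnerPointOfConductor_mem_range_map_ringClassField_holds (W.conductorNorm ℤ) W K)
    exists_generator_ringClassGalOver_holds hK hHN Dt β ι d.dvd_sq_sub hmsq hinert
  -- (2) a datum of conductor `mℓ` COMPATIBLE with `d₀` (Gross's one system of choices, read upward)
  obtain ⟨dℓ, hdℓ⟩ := Summit.BirchSwinnertonDyer.Rank1Residual.JET.exists_compatible_data_of_grossCM
    (phi_heegnerPointOfConductor_mem_range_map_ringClassField_holds (W.conductorNorm ℤ) W K) hK hD hHN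
    2 Dt β ι hmsq hSm d₀
  obtain ⟨hσ, hS₁, hS₂, hemb⟩ := hdℓ ℓ hKol hℓc
  -- (3) Q2 OFF THE HABITAT for the compatible pair `(d₀, d'')`, second conjunct, `j = 0`, `c_M(m)(d₀) = 0`
  have hQ2 := (GenusExact.kolyvaginRelationAtTwo_offHabitat_of_frobeniusCongruence h37 W hCM K hK hne3 hne4
    hHN htorQ Dt β ι M hM m ℓ hsq hℓ hℓm hS d₀ (dℓ ℓ hKol hℓc) hσ hS₁ hS₂ hemb v hv 0).2
  have h0 : ((2 ^ 0 : ℕ) : ℤ) • d₀.kolyvaginClass Nat.prime_two M ∈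
      (W.baseChange K).torsionLocalKer (v.adicCompletion K) ((2 ^ M : ℕ) : ℤ) := by
    rw [hvan d₀, zsmul_zero]
    exact zero_mem _
  have h'' := hQ2.mpr h0
  -- (4) choice independence at the Zhang–Kolyvagin level `mℓ` (admissibility at `2` OFF the habitat)
  have hA'' : KolyvaginCocycle.IsAdmissible (Field.absoluteGaloisGroup K) (dℓ ℓ hKol hℓc).pointsSubgroup
      ((2 ^ M : ℕ) : ℤ) :=
    GenusExact.isAdmissible_pointsSubgroup_two_of_torsionBy_eq_bot (dℓ ℓ hKol hℓc) htorQ hK hn0 hne4 hHN M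
  have hsw := (Prop44.zsmul_kolyvaginClass_mem_iff_of_sameLevel hK ι hD hHN Dt Nat.prime_two hM hsq
    hS (dℓ ℓ hKol hℓc) d hA''
    ((W.baseChange K).torsionLocalKer (v.adicCompletion K) ((2 ^ M : ℕ) : ℤ)) ((2 ^ 0 : ℕ) : ℤ)).mpr h''
  rw [show ((2 ^ 0 : ℕ) : ℤ) = 1 by norm_num, one_zsmul] at hsw
  exact hsw

/-- **T1 OFF THE HABITAT** — the text of the habitat stub `stub_localTrivialAtConductor` (line `kolyvagin_depth_split`)
with the binder `(∀ m, ρ̄_{E,2^m} onto)` replaced by `E(ℚ)[2] = 0` (R_irr's frame), from Gross 1991 Prop. 3.7 (2)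
(`h37`): if `n ∈ Λ` (square-free product of Kolyvagin primes at `2`), `1 ≤ M`, `M + 1 ≤ M(n)`, `ℓ ∣ n`, and EVERY
class `c_M(n/ℓ)` vanishes, then `c_M(n) ∈ ker (H¹(K, E[2^M]) → H¹(K_λ, E[2^M]))` for the place `λ ∋ ℓ`.
Plug-in replacement of T1 for the re-threading of V2irr / U2irr (LINE 8∞ on stmt-27123). CONDITIONAL on `h37`.
[cite: McCallumLMS1991, §4 Prop. 4.4 «In particular» (p. 301), Cor. 4.5] [cite: GrossLMS1991, §3 Prop. 3.7, §6 Prop. 6.2 (2)]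
[cite: Kolyvagin1991MathAnn, §2 Thm. 2.2] -/
theorem localTrivialAtConductor_offHabitat_of_frobeniusCongruence (h37 : prop37_2_frobeniusCongruence) :
    ∀ (W : WeierstrassCurve ℚ) [W.IsElliptic] [W.IsGloballyMinimal], ¬ W.HasCM →
      (Rank1Residual.GoodOrd W 2 ∨ Rank1Residual.Mult W 2) →
      AddSubgroup.torsionBy W.toAffine.Point (2 : ℤ) = ⊥ →
      ∀ (K : Type) [Field K] [NumberField K], IsImaginaryQuadratic K → NumberField.discr K ≠ -3 →
      NumberField.discr K ≠ -4 → ¬ ((2 : ℤ) ∣ NumberField.discr K) → ∀ [NeZero (W.conductorNorm ℤ)],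
      SatisfiesHeegnerHypothesis (W.conductorNorm ℤ) K →
      ∀ (Dt : ModularParametrizationData W (W.conductorNorm ℤ)) (β : ℤ) (ι : K →+* ℂ)
        (n : ℕ) (d : KolyvaginHeegnerData Dt β ι n) (M ℓ : ℕ),
        KolyvaginDescent.KolSupp (Zhang2014.IsKolyvaginPrime (W.conductorNorm ℤ) W K 2) n →
        1 ≤ M → ((M + 1 : ℕ) : ℕ∞) ≤ Zhang2014.levelIndex W 2 n → ℓ ∈ n.primeFactors →
        (∀ d₀ : KolyvaginHeegnerData Dt β ι (n / ℓ), d₀.kolyvaginClass Nat.prime_two M = 0) →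
        ∀ v : HeightOneSpectrum (𝓞 K), ((ℓ : ℕ) : 𝓞 K) ∈ v.asIdeal →
          d.kolyvaginClass Nat.prime_two M ∈
            (W.baseChange K).torsionLocalKer (v.adicCompletion K) ((2 ^ M : ℕ) : ℤ) := by
  intro W _ _ hCM _hred htorQ K _ _ hK hne3 hne4 _h2d _ hHN Dt β ι n d M ℓ hn hM1 hMle hℓ hvan v hv
  obtain ⟨hℓp, hℓn, -⟩ := Nat.mem_primeFactors.mp hℓ
  obtain ⟨m, rfl⟩ : ∃ m, n = m * ℓ := ⟨n / ℓ, (Nat.div_mul_cancel hℓn).symm⟩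
  rw [Nat.mul_div_cancel m hℓp.pos] at hvan
  have hsq : Squarefree (m * ℓ) := hn.1
  have hℓm : ¬ ℓ ∣ m := fun h ↦
    hℓp.one_lt.ne' (Nat.isUnit_iff.mp (hsq ℓ (mul_dvd_mul_right h ℓ)))
  have hS : ∀ q ∈ (m * ℓ).primeFactors, Zhang2014.IsKolyvaginPrime (W.conductorNorm ℤ) W K 2 q ∧
      M ≤ Zhang2014.kolyvaginIndex W 2 q := fun q hq ↦
    ⟨hn.2 q hq, (Nat.le_succ M).trans ((Zhang2014.natCast_le_levelIndex_iff.mp hMle) q hq)⟩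
  exact kolyvaginClass_mem_torsionLocalKer_offHabitat_of_frobeniusCongruence h37 W hCM htorQ hK hne3 hne4
    hHN Dt β ι hsq hℓp hℓm hM1 hS d hvan v hv

/-! ### Q2 off the habitat through a cast of the conductor (appended, krr2-p2 g10; used by the off-habitat swap core) -/

/-- The off-habitat Q2 `GenusExact.kolyvaginRelationAtTwo_offHabitat_of_frobeniusCongruence` (binder `E(ℚ)[2] = 0`)
with the datum of conductor `m l` given at a conductor `N = m l` (through the cast `subst`); twin of the habitat
`kolyvaginRelationAtTwo_cast`. CONDITIONAL on Gross 1991 Prop. 3.7 (2) (`h37`).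
[cite: McCallumLMS1991, §4 Prop. 4.4] [cite: GrossLMS1991, Prop. 3.7, Prop. 6.2] -/
theorem kolyvaginRelationAtTwo_cast_offHabitat (h37 : prop37_2_frobeniusCongruence)
    (W : WeierstrassCurve ℚ) [W.IsElliptic] [W.IsGloballyMinimal] [NeZero (W.conductorNorm ℤ)] (hCM : ¬ W.HasCM) (htorQ : AddSubgroup.torsionBy W.toAffine.Point (2 : ℤ) = ⊥)
    (hK : IsImaginaryQuadratic K) (hne3 : NumberField.discr K ≠ -3) (hne4 : NumberField.discr K ≠ -4)
    (hHN : SatisfiesHeegnerHypothesis (W.conductorNorm ℤ) K)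
    (Dt : ModularParametrizationData W (W.conductorNorm ℤ)) (β : ℤ) (ι : K →+* ℂ)
    (M : ℕ) (hM : 1 ≤ M) {m l N : ℕ} (hN : m * l = N)
    (hsq : Squarefree N) (hl : l.Prime) (hlm : ¬ l ∣ m)
    (hK' : ∀ l' ∈ N.primeFactors, Zhang2014.IsKolyvaginPrime (W.conductorNorm ℤ) W K 2 l' ∧
      M ≤ Zhang2014.kolyvaginIndex W 2 l')
    (d : KolyvaginHeegnerData Dt β ι m) (d' : KolyvaginHeegnerData Dt β ι N)
    (hσ : ∀ l' ∈ m.primeFactors, ∀ (x : ringClassField K ι m) (x' : ringClassField K ι N),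
      (x : ℂ) = x' → ((d'.σ l' x' : ringClassField K ι N) : ℂ) = (d.σ l' x : ℂ))
    (hS : ∀ s ∈ d.S, ∃ s' ∈ d'.S, ∀ (x : ringClassField K ι m) (x' : ringClassField K ι N),
      (x : ℂ) = x' → ((s' x' : ringClassField K ι N) : ℂ) = (s x : ℂ))
    (hS' : ∀ s' ∈ d'.S, ∃ s ∈ d.S, ∀ (x : ringClassField K ι m) (x' : ringClassField K ι N),
      (x : ℂ) = x' → ((s' x' : ringClassField K ι N) : ℂ) = (s x : ℂ))
    (hemb : ∀ (x : ringClassField K ι m) (x' : ringClassField K ι N), (x : ℂ) = x' → d'.emb x' = d.emb x)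
    (v : HeightOneSpectrum (𝓞 K)) (hv : ((l : ℕ) : 𝓞 K) ∈ v.asIdeal) (j : ℕ) :
    (((2 ^ j : ℕ) : ℤ) • d'.kolyvaginClass Nat.prime_two M ∈
        selmerLocalKer (W.baseChange K) (v.adicCompletion K) ((2 ^ M : ℕ) : ℤ) ↔
      ((2 ^ j : ℕ) : ℤ) • d'.kolyvaginClass Nat.prime_two M ∈
        (W.baseChange K).torsionLocalKer (v.adicCompletion K) ((2 ^ M : ℕ) : ℤ)) ∧
    (((2 ^ j : ℕ) : ℤ) • d'.kolyvaginClass Nat.prime_two M ∈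
        (W.baseChange K).torsionLocalKer (v.adicCompletion K) ((2 ^ M : ℕ) : ℤ) ↔
      ((2 ^ j : ℕ) : ℤ) • d.kolyvaginClass Nat.prime_two M ∈
        (W.baseChange K).torsionLocalKer (v.adicCompletion K) ((2 ^ M : ℕ) : ℤ)) := by
  subst hN
  exact GenusExact.kolyvaginRelationAtTwo_offHabitat_of_frobeniusCongruence h37 W hCM K hK hne3 hne4 hHN htorQ
    Dt β ι M hM m l hsq hl hlm hK' d d' hσ hS hS' hemb v hv j

end Summit.BirchSwinnertonDyer.BirchSwinnertonDyer.Theorems.KolyvaginLowerBoundAtTwo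

end
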